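import Literature.NumberTheory.Automorphic.CDTTheorem712
import HarnessLib

/-!
# Stub-ideation k = 2, GENERATION 12 (home family 2 — RESHAPE) for `stub_modThree`

Companion of `STUB-IDEAS-stub_modThree-2.md` (gen 12).  Nothing registered; the stub statement is
copied verbatim as `SigStubModThree`.  This generation adds no prover work; it types the two
family-2 closures that make the freeze of this stub a STATEMENT rather than a mood:

* **T8 — the `W`-binder is automorphically inert (a sandwich).**  `WeakSerreCyclo3` = "every
  absolutely irreducible `ρ̄ : Γ_ℚ → GL₂(𝔽₃)` with `det ρ̄ = χ̄₃` is modular (`ModPGaloisRep.IsModular`,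
  any weight)".  `stub_of_weakSerreCyclo3 : WeakSerreCyclo3 → SigStubModThree` is PROVED (Weil pairing,
  tree theorem `det_eq_modPCyclotomicCharacter_of_isTorsionGaloisRep_holds`); the converse
  `weakSerreCyclo3_of_stub` is PROVED granted the classical named fact
  `exists_isTorsionGaloisRep_three_of_det` (every `ρ̄` with cyclotomic determinant is `E[3]` for an
  elliptic curve `E/ℚ`: the twist `X_ρ̄(3)` of `X(3) ≅ ℙ¹` carries the Hodge bundle `ω`, of odd degree
  `1`, hence is `ℙ¹_ℚ` — the `p = 3` twin of the tree's vendored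
  `BCDT.exists_isTorsionGaloisRep_five_and_surjective_three`, Shepherd-Barron–Taylor 1997 §1).  So the
  typed stub is EXACTLY weak Serre on the cyclotomic-determinant class `𝒞₃`: no elliptic-curve structure
  (Tate module, heights, isogenies, the use-site hypotheses `9 ∤ N_W`, Frey shape) survives in it.
* **T7 — weaken-and-bootstrap through the pencil `X_ρ̄(3)`, as a typed door.**
  `weakSerreCyclo3_of_realisation`: if every `ρ̄ ∈ 𝒞₃` is `W'[3]` for a curve `W'` in a class `𝓜` of
  curves known to be modular, then `WeakSerreCyclo3` (transport
  `IsModular.isModular_of_isTorsionGaloisRep''`, unconditional in the tree).  PROVED; the md page's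
  census shows no classical `𝓜` (CM; small mod-`ℓ` image for `ℓ ≥ 5` — Faltings-finite loci of genus
  `3, 7, 10, 4` at `ℓ = 5`; Allen's nearly-ordinary dihedral-mod-2 class — excluded on the wild core by
  k2 g3 NG1/NG2) meets every pencil, and `𝓜 = all curves` is BCDT, i.e. the summit of this crux.
-/

open scoped MatrixGroups NumberField
open Literature.NumberTheory.EllipticCurves
open Literature.NumberTheory.Automorphic
open Literature.NumberTheory.Automorphic.BCDT
open Literature.NumberTheory.GaloisRepresentations
open WeierstrassCurve

set_option linter.dupNamespace false
set_option autoImplicit false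

namespace Summit.ABC.ABC.Cruxes.FreyModularity.StubModThreeIdeasK2G12

noncomputable section

/-- The registered stub statement, verbatim. -/
def SigStubModThree : Prop :=
  ∀ (W : WeierstrassCurve ℚ) [W.IsElliptic] (ρ : ModPGaloisRep ℚ (ZMod 3) 2),
    W.IsTorsionGaloisRep 3 ρ → FramedRep.IsAbsolutelyIrreducible ρ → ρ.IsModular

/-- **The cyclotomic-determinant class `𝒞₃` is weakly Serre-modular**: every absolutely irreducible
`ρ̄ : Γ_ℚ →ₜ* GL₂(𝔽₃)` with `det ρ̄ = χ̄₃` is modular in BCDT's sense (some newform of some weight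
`≥ 1` and level reduces to `ρ̄`).  Langlands–Tunnell (via `Ψ : GL₂(𝔽₃) ↪ GL₂(ℤ[√-2])`),
Khare–Wintenberger at `p = 3`, or Allen–Khare–Thorne 2021 each prove it; none is in the tree.
[cite: Wiles1995Annals, Ch. 5] -/
def WeakSerreCyclo3 : Prop :=
  ∀ ρ : ModPGaloisRep ℚ (ZMod 3) 2,
    (∀ σ : Field.absoluteGaloisGroup ℚ,
      Matrix.GeneralLinearGroup.det (ρ σ) = modPCyclotomicCharacterZMod ℚ 3 σ) →
    FramedRep.IsAbsolutelyIrreducible ρ → ρ.IsModular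

/-- **Named classical fact (H2, size M; not in the tree — no modular curves).**  Every continuous
`ρ̄ : Γ_ℚ →ₜ* GL₂(𝔽₃)` with cyclotomic determinant is the mod-`3` representation of an elliptic
curve over `ℚ`: the moduli problem "(E, E[3] ≅ ρ̄ symplectically)" is a twist `X_ρ̄(3)` of
`X(3) ≅ ℙ¹`; it carries the Hodge line bundle `ω` (rigid level structure, `3 ≥ 3`) with
`ω^{⊗2} ≅ Ω¹(cusps)`, so `deg ω = (2·0 - 2 + 4)/2 = 1` is odd and the genus-`0` curve `X_ρ̄(3)` is
`ℙ¹_ℚ`; its non-cuspidal rational points are the required curves (infinitely many).  This is the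
`p = 3` twin of the tree's vendored `exists_isTorsionGaloisRep_five_and_surjective_three`
(Shepherd-Barron–Taylor 1997 §1, `deg ω = 5` on `X(5)`); given ONE realisation the whole family is
Rubin–Silverberg 1995 Thm. 4.1. [cite: BCDTJAMS2001, §2.2 (proof of Thm. 2.2.1, third step)] -/
def exists_isTorsionGaloisRep_three_of_det : Prop :=
  ∀ ρ : ModPGaloisRep ℚ (ZMod 3) 2,
    (∀ σ : Field.absoluteGaloisGroup ℚ,
      Matrix.GeneralLinearGroup.det (ρ σ) = modPCyclotomicCharacterZMod ℚ 3 σ) →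
    ∃ (W : WeierstrassCurve ℚ) (_ : W.IsElliptic), W.IsTorsionGaloisRep 3 ρ

/-- **T8, lower half (PROVED): weak Serre on `𝒞₃` gives the stub** — the `W`-binder of the stub
contributes `det ρ̄ = χ̄₃` (Weil pairing, tree theorem) and nothing else. [folklore] -/
theorem stub_of_weakSerreCyclo3 (h : WeakSerreCyclo3) : SigStubModThree := by
  intro W _ ρ hρ habs
  exact h ρ (W.det_eq_modPCyclotomicCharacter_of_isTorsionGaloisRep_holds 3 ρ hρ) habs

/-- **T8, upper half (PROVED granted H2): the stub gives weak Serre on all of `𝒞₃`** — so the typed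
stub is not a special case of Langlands–Tunnell-for-`GL₂(𝔽₃)`-with-cyclotomic-determinant but the
whole of it (in BCDT's weak, weight-free form). [folklore] -/
theorem weakSerreCyclo3_of_stub (hX : exists_isTorsionGaloisRep_three_of_det)
    (h : SigStubModThree) : WeakSerreCyclo3 := by
  intro ρ hdet habs
  obtain ⟨W, hW, hρ⟩ := hX ρ hdet
  exact h W ρ hρ habs

/-- **T8, the sandwich**: granted H2, the registered stub and weak Serre on `𝒞₃` are the same
statement. [folklore] -/
theorem stub_iff_weakSerreCyclo3 (hX : exists_isTorsionGaloisRep_three_of_det) :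
    SigStubModThree ↔ WeakSerreCyclo3 :=
  ⟨weakSerreCyclo3_of_stub hX, stub_of_weakSerreCyclo3⟩

/-- **T7's door: a class `𝓜` of curves realising every `ρ̄ ∈ 𝒞₃` on its `3`-torsion.**  (For
`𝓜 = ⊤` this is H2; the bootstrap needs it for a class `𝓜` of curves modular for a classical
reason.) [folklore] -/
def RealisesCycloThree (𝓜 : WeierstrassCurve ℚ → Prop) : Prop :=
  ∀ ρ : ModPGaloisRep ℚ (ZMod 3) 2,
    (∀ σ : Field.absoluteGaloisGroup ℚ,
      Matrix.GeneralLinearGroup.det (ρ σ) = modPCyclotomicCharacterZMod ℚ 3 σ) →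
    FramedRep.IsAbsolutelyIrreducible ρ →
    ∃ (W : WeierstrassCurve ℚ) (_ : W.IsElliptic), 𝓜 W ∧ W.IsTorsionGaloisRep 3 ρ

/-- **T7 (PROVED): bootstrap through the pencil.**  If a class `𝓜` of MODULAR curves realises every
`ρ̄ ∈ 𝒞₃`, then weak Serre holds on `𝒞₃` (hence the stub, by `stub_of_weakSerreCyclo3`): transport of
modularity from `W'` to `W'[3]` is the tree's unconditional
`IsModular.isModular_of_isTorsionGaloisRep''`.  The md census shows no classically modular `𝓜`
qualifies (CM: wrong image; small image mod `ℓ ≥ 5`: Faltings-finite; Allen's class: misses the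
wild core), and `𝓜 = ⊤` modular is BCDT itself. [cite: BCDTJAMS2001, Introduction ((2) ⇒ (4))] -/
theorem weakSerreCyclo3_of_realisation (𝓜 : WeierstrassCurve ℚ → Prop)
    (hmod : ∀ (W : WeierstrassCurve ℚ) [W.IsElliptic] [NeZero (W.conductorNorm ℤ)],
      𝓜 W → IsModular W)
    (hR : RealisesCycloThree 𝓜) : WeakSerreCyclo3 := by
  intro ρ hdet habs
  obtain ⟨W, hW, hM, hρ⟩ := hR ρ hdet habs
  haveI : NeZero (W.conductorNorm ℤ) := ⟨(conductorNorm_pos_holds W).ne'⟩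
  exact (hmod W hM).isModular_of_isTorsionGaloisRep'' hρ

/-- **T7 ∘ T8 (PROVED): the stub from a modular realising class.** [folklore] -/
theorem stub_of_realisation (𝓜 : WeierstrassCurve ℚ → Prop)
    (hmod : ∀ (W : WeierstrassCurve ℚ) [W.IsElliptic] [NeZero (W.conductorNorm ℤ)],
      𝓜 W → IsModular W)
    (hR : RealisesCycloThree 𝓜) : SigStubModThree :=
  stub_of_weakSerreCyclo3 (weakSerreCyclo3_of_realisation 𝓜 hmod hR)

end

end Summit.ABC.ABC.Cruxes.FreyModularity.StubModThreeIdeasK2G12
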